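import Summits.AtomisticToContinuum.Crystallization.Theorems.FrustratedLawDichotomyStrainedPatchHomEntrySemanticQuotBulk

/-!
# (H) hcp quotient root — the FLIP LEAF: a `Σ`-box with `ξ₀ < 0` or `ξ₂ < 0` is certified by the verdict of record evaluated on its REFLECTED box
# (27623 `(H) HomFloor`, hcp half; lens-5 g95, answer to hand-1 g43 «D3» (STATUS l.7983); cures the `ξ₂ < 0` table-coverage dip WITHOUT new tables or constants)

decomp-a2c lens-5 g95 (crux `AperiodicFrustratedLawGap`, stmt-AtomisticToContinuum-27623).

THE DEFECT (hand-1 g43 D3).  NODE 88's quotient root spends the two coordinate reflections `F₀, F₂` on the ENTRY walls (`0 ≤ u₀₁`, `u₁₂ ≤ 0`) and the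
`C₃`/mirror symmetries on the sector `Σ = {ξ₁ ≤ 0, ξ₀² ≤ 3ξ₁²}` — so the shuffle `ξ` now ranges over BOTH signs of `ξ₀` and `ξ₂`, whereas every table of
record (`qTableK1–K4`, vector and class form) was built for the OLD fundamental domain `{ξ₀ ≥ 0, ξ₂ ≥ 0}` (hand-2 g24/g25).  On the `ξ₂ < 0` half the tables'
coverage radius dips below the ball radius `1/4` (ray `∝ (7,−3,−15)`: accept to `0.248`; its `z`-mirror: through `0.255`), so sphere-touching `Σ`-boxes there
close neither by tables nor by `ballOut`.

THE CURE (this file, ~no mathematics).  The reflections are involutions that may be used POINTWISE inside any leaf, independently of how the root was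
quotiented: `semOKHQ μ` has no wall hypothesis, and `F₀`, `F₂` preserve self-adjointness, positivity, `‖U − 1‖ ≤ 1/4`, `‖ξ‖ ≤ 1/4` AND the sector `Σ`
(`ξ₁` fixed, `ξ₀ ↦ ±ξ₀`).  Hence ★ `semOKHQ_of_semOKHQ_flip`: if the REFLECTED box `(cflip i c, w)` (`i ∈ {0, 2}`; entries `u_ab ↦ ε_a ε_b u_ab`, shuffle
`ξ_i ↦ −ξ_i`, widths unchanged) is a `semOKHQ μ` fact, so is `(c, w)` — by `…SemanticQuotA.hcpLeafGoal_of_flip` and the box transport `…SemanticQuotB.mem_flipC`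
(both landed, node 88; QuotB's `semOKHQ_of_semOKH_quad` is the four-image OLD-currency version — the single-image `Q → Q` transport is what a driver needs).  The driver-side verdicts: ★ `quarterCoreQ μ c w := quickCoreQ μ (toQuarter c) w` — reflect the box into the old
table domain `{ξ₀ ≥ 0, ξ₂ ≥ 0}` by the signs of its shuffle CENTRE, then run the sign-free quick verdict of record (`…QuotBulk.quickCoreQ`: V-tables K1–K4,
sharp fit, fit, class tables, radial, column) — and ★★ `bulkLeafCQF μ := bulkLeafCQ μ ∨ quarterCoreQ μ` with `semOKHQ_of_bulkLeafCQF` and the literal-tree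
currency `semOKHQ_of_treeOK_bulkLeafCQF`.  Every reflected box lies in the OLD fundamental domain `{ξ₀ ≥ 0, ξ₂ ≥ 0}` (all `U` of the entry root) for which these very tables were generated and
coverage-audited (hand-2 g24/g25), and `(U, ξ) ↦ (F₂UF₂, F₂ξ)` is a bijection of the `ξ₂ < 0` shell onto its mirror: the coverage of the `ξ₂ < 0` (and
`ξ₀ < 0`) shell under `quarterCoreQ` is, box for box, the tables' coverage of the old domain (D3's own probe: the `z`-mirror ray accepts through `0.255 > 1/4`): D3's cure (b′) «regenerate the tables symmetric in `ξ₂`» is unnecessary, (a) «ball `1/4 → 0.248`» (a landed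
constant threaded through `…HomPrunedPolar` → `…FlipHcp` → `…SemanticQuot*`) is untouched, (c′) is moot.  The conjugated `U`-box leaves the entry quarter —
irrelevant: the tables and fits are sound and were generated on the whole entry root.

* §1 ★ `semOKHQ_of_semOKHQ_flip` (over the landed `flipC` / `mem_flipC`), `flipC_flipC`.
* §2 `toQuarter`, ★ `quarterCoreQ`, ★★ `bulkLeafCQF` + `semOKHQ_of_quarterCoreQ` / `semOKHQ_of_bulkLeafCQF` / `semOKHQ_of_treeOK_bulkLeafCQF` (drop-in for
  `semOKHQ_of_treeOK_bulkLeafCQ` in the R5 plan driver: search with `bulkLeafCQF muRec`; old shards stay valid since `bulkLeafCQ ⇒ bulkLeafCQF`).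
* §3 bookkeeping (`bulkLeafCQF_of_bulkLeafCQ`, `treeOK_bulkLeafCQF_of_bulkLeafCQ`) and a `decide` smoke of the box reflection on literal data.

Definitions computable; formal bookkeeping only; 0 sorry; standard axioms; no instances / notation / `#eval`.  `--supports stmt-AtomisticToContinuum-27623`.
-/

namespace Summit.AtomisticToContinuum.Crystallization.Theorems.FrustratedLawDichotomyStrainedPatchHomEntrySemanticQuot

open scoped BigOperators RealInnerProductSpace
open Literature.Analysis.ValidatedNumerics.Numerics
open Summit.AtomisticToContinuum.Crystallization.Theorems.ChargedEnergyGapNegative (E3)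
open Summit.AtomisticToContinuum.Crystallization.Theorems.FrustratedLawDichotomyStrainedPatchHomCertTree (CertTree treeOK)
open Summit.AtomisticToContinuum.Crystallization.Theorems.FrustratedLawDichotomyStrainedPatchHomEntrySignKit (flipIso flipIso_apply)
open Summit.AtomisticToContinuum.Crystallization.Theorems.FrustratedLawDichotomyStrainedPatchHomEntryLeafHT
  (hcpCoord HcpLeafGoal quickCoreQ bulkLeafCQ semOKHQ_of_quickCoreQ semOKHQ_of_bulkLeafCQ)

/-! ## §1. The semantic flip lemma (single image, quotient currency → quotient currency) -/

/-- `flipC i` is an involution. [formal bookkeeping] -/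
theorem flipC_flipC (i : Fin 3) (c : (Fin 3 × Fin 3) ⊕ Fin 3 → ℤ) : flipC i (flipC i c) = c := by
  funext k
  rcases k with ⟨a, b⟩ | j
  · have ha : sgnF i a * sgnF i a = 1 := by unfold sgnF; split_ifs <;> norm_num
    have hb : sgnF i b * sgnF i b = 1 := by unfold sgnF; split_ifs <;> norm_num
    simp only [flipC, Sum.elim_inl]
    calc sgnF i a * sgnF i b * (sgnF i a * sgnF i b * c (Sum.inl (a, b)))
        = (sgnF i a * sgnF i a) * (sgnF i b * sgnF i b) * c (Sum.inl (a, b)) := by ring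
      _ = c (Sum.inl (a, b)) := by rw [ha, hb, one_mul, one_mul]
  · simp only [flipC, Sum.elim_inr]
    split_ifs <;> simp

/-- ★ **THE SEMANTIC FLIP LEMMA**: a `Σ`-box whose `F_i`-REFLECTION (`i ∈ {0, 2}`) is a `semOKHQ μ` fact is itself a `semOKHQ μ` fact — the reflections
preserve self-adjointness, positivity, `‖U − 1‖ ≤ 1/4`, `‖ξ‖ ≤ 1/4` and the sector (`ξ₁` fixed, `ξ₀² ` fixed), and the leaf conclusion transports back by
`hcpLeafGoal_of_flip`.  No wall hypothesis is involved: the quotient's entry walls restrict the ROOT, never a leaf. [folklore] -/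
theorem semOKHQ_of_semOKHQ_flip {i : Fin 3} (hi : i = 0 ∨ i = 2) {μ : ℤ} {c w : (Fin 3 × Fin 3) ⊕ Fin 3 → ℤ}
    (h : semOKHQ μ (flipC i c) w = true) : semOKHQ μ c w = true :=
  semOKHQ_of_forall fun U ξ hsa hpos hU hξ hmem hb hab => by
    obtain ⟨s1, p1, n1⟩ := conj_data (flipIso i) hsa hpos hU
    have h1 : (flipIso i ξ) 1 = ξ 1 := by
      rw [flipIso_apply]
      rcases hi with rfl | rfl <;> simp
    have h0 : ((flipIso i ξ) 0) ^ 2 = (ξ 0) ^ 2 := by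
      rw [flipIso_apply]
      split_ifs <;> ring
    exact hcpLeafGoal_of_flip hi U ξ hU hξ
      (semOKHQ_forall h _ _ s1 p1 n1 (norm_iso_le (flipIso i) hξ) (mem_flipC i hmem) (by rw [h1]; exact hb) (by rw [h0, h1]; exact hab))

/-! ## §2. The driver-side verdicts: reflect into the old table quarter, then the quick verdict of record -/

/-- Reflect a box into the OLD table domain `{ξ₀ ≥ 0, ξ₂ ≥ 0}` by the signs of its shuffle centre: `F₂` if `c(ξ₂) < 0`, then `F₀` if `c(ξ₀) < 0`. -/
def toQuarter (c : (Fin 3 × Fin 3) ⊕ Fin 3 → ℤ) : (Fin 3 × Fin 3) ⊕ Fin 3 → ℤ :=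
  let c₂ := if c (Sum.inr 2) < 0 then flipC 2 c else c
  if c₂ (Sum.inr 0) < 0 then flipC 0 c₂ else c₂

/-- A `semOKHQ` fact on the quarter-reflected box is one on the box. [formal bookkeeping: `semOKHQ_of_semOKHQ_flip` at most twice] -/
theorem semOKHQ_of_semOKHQ_toQuarter {μ : ℤ} {c w : (Fin 3 × Fin 3) ⊕ Fin 3 → ℤ} (h : semOKHQ μ (toQuarter c) w = true) : semOKHQ μ c w = true := by
  unfold toQuarter at h
  simp only at h
  split_ifs at h with h2 h0 h0'
  · exact semOKHQ_of_semOKHQ_flip (Or.inr rfl) (semOKHQ_of_semOKHQ_flip (Or.inl rfl) h)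
  · exact semOKHQ_of_semOKHQ_flip (Or.inr rfl) h
  · exact semOKHQ_of_semOKHQ_flip (Or.inl rfl) h
  · exact h

/-- ★ **THE QUARTER-REFLECTED QUICK VERDICT**: the sign-free quick verdict of record (`quickCoreQ`: V-tables K1–K4, sharp fit, fit, class tables K1–K4,
radial, column) evaluated on the box reflected into `{ξ₀ ≥ 0, ξ₂ ≥ 0}` — the domain the tables were generated for. Computable. -/
def quarterCoreQ (μ : ℤ) (c w : (Fin 3 × Fin 3) ⊕ Fin 3 → ℤ) : Bool := quickCoreQ μ (toQuarter c) w

/-- ★ A box accepted by `quarterCoreQ μ` is a `semOKHQ μ` fact. [formal bookkeeping] -/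
theorem semOKHQ_of_quarterCoreQ {μ : ℤ} {c w : (Fin 3 × Fin 3) ⊕ Fin 3 → ℤ} (h : quarterCoreQ μ c w = true) : semOKHQ μ c w = true :=
  semOKHQ_of_semOKHQ_toQuarter (semOKHQ_of_quickCoreQ h)

/-- ★★ **THE SEARCH-GRADE BULK VERDICT WITH THE FLIP LEAF** (drop-in for `bulkLeafCQ` in the R5 plan driver): the bulk verdict of record first (sector /
ball prunes, quick verdict on the box as it stands), then the quarter-reflected quick verdict. Computable. -/
def bulkLeafCQF (μ : ℤ) (c w : (Fin 3 × Fin 3) ⊕ Fin 3 → ℤ) : Bool := bulkLeafCQ μ c w || quarterCoreQ μ c w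

/-- ★★ A box accepted by `bulkLeafCQF μ` is a `semOKHQ μ` fact. [formal bookkeeping] -/
theorem semOKHQ_of_bulkLeafCQF {μ : ℤ} {c w : (Fin 3 × Fin 3) ⊕ Fin 3 → ℤ} (h : bulkLeafCQF μ c w = true) : semOKHQ μ c w = true := by
  simp only [bulkLeafCQF, Bool.or_eq_true] at h
  rcases h with h | h
  · exact semOKHQ_of_bulkLeafCQ h
  · exact semOKHQ_of_quarterCoreQ h

/-- ★★ SHARD CURRENCY for `bulkLeafCQF` (literal kernel tree): replaces `semOKHQ_of_treeOK_bulkLeafCQ` verbatim in the shard files. [formal bookkeeping] -/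
theorem semOKHQ_of_treeOK_bulkLeafCQF {μ : ℤ} (t : CertTree ((Fin 3 × Fin 3) ⊕ Fin 3)) {c w : (Fin 3 × Fin 3) ⊕ Fin 3 → ℤ}
    (h : treeOK (bulkLeafCQF μ) t c w = true) : semOKHQ μ c w = true :=
  semOKHQ_of_treeOK (bulkLeafCQF μ) (fun _ _ h' => semOKHQ_of_bulkLeafCQF h') t c w h

/-! ## §3. Bookkeeping and smoke -/

/-- Old shards stay valid: `bulkLeafCQ ⇒ bulkLeafCQF` pointwise. [formal bookkeeping] -/
theorem bulkLeafCQF_of_bulkLeafCQ {μ : ℤ} {c w : (Fin 3 × Fin 3) ⊕ Fin 3 → ℤ} (h : bulkLeafCQ μ c w = true) : bulkLeafCQF μ c w = true := by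
  simp only [bulkLeafCQF, h, Bool.true_or]

/-- A tree accepted by `bulkLeafCQ` is accepted by `bulkLeafCQF`. [formal bookkeeping: induction on the tree] -/
theorem treeOK_bulkLeafCQF_of_bulkLeafCQ {μ : ℤ} :
    ∀ (t : CertTree ((Fin 3 × Fin 3) ⊕ Fin 3)) (c w : (Fin 3 × Fin 3) ⊕ Fin 3 → ℤ), treeOK (bulkLeafCQ μ) t c w = true → treeOK (bulkLeafCQF μ) t c w = true
  | .leaf, c, w, h => by simpa [treeOK] using bulkLeafCQF_of_bulkLeafCQ (μ := μ) (by simpa [treeOK] using h)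
  | .split k l r, c, w, h => by
    simp only [treeOK, Bool.and_eq_true] at h ⊢
    exact ⟨⟨h.1.1, treeOK_bulkLeafCQF_of_bulkLeafCQ l _ _ h.1.2⟩, treeOK_bulkLeafCQF_of_bulkLeafCQ r _ _ h.2⟩

/-- Smoke (literal data, `decide`): the `F₂`-reflection negates `u₀₂, u₂₀, u₁₂, u₂₁` and `ξ₂`, keeps the rest; `toQuarter` lands a `(−,·,−)` shuffle
centre in `(+,·,+)` and conjugates the entries by `F₀F₂`. -/
example : flipC 2 (fun _ => 3) (Sum.inl (0, 2)) = -3 ∧ flipC 2 (fun _ => 3) (Sum.inl (2, 2)) = 3 ∧ flipC 2 (fun _ => 3) (Sum.inl (0, 1)) = 3 ∧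
    flipC 2 (fun _ => 3) (Sum.inr 2) = -3 ∧ flipC 2 (fun _ => 3) (Sum.inr 1) = 3 ∧
    toQuarter (Sum.elim (fun _ => (5 : ℤ)) (fun i => if i = 1 then -7 else -2)) (Sum.inr 0) = 2 ∧
    toQuarter (Sum.elim (fun _ => (5 : ℤ)) (fun i => if i = 1 then -7 else -2)) (Sum.inr 2) = 2 ∧
    toQuarter (Sum.elim (fun _ => (5 : ℤ)) (fun i => if i = 1 then -7 else -2)) (Sum.inr 1) = -7 ∧
    toQuarter (Sum.elim (fun _ => (5 : ℤ)) (fun i => if i = 1 then -7 else -2)) (Sum.inl (0, 2)) = 5 ∧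
    toQuarter (Sum.elim (fun _ => (5 : ℤ)) (fun i => if i = 1 then -7 else -2)) (Sum.inl (0, 1)) = -5 ∧
    toQuarter (Sum.elim (fun _ => (5 : ℤ)) (fun i => if i = 1 then -7 else -2)) (Sum.inl (1, 2)) = -5 := by
  decide

end Summit.AtomisticToContinuum.Crystallization.Theorems.FrustratedLawDichotomyStrainedPatchHomEntrySemanticQuot
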